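import Mathlib.Data.Real.Basic
import Summits.CriticalPhenomena.PercolationContinuityZ3.Theorems.Transplant.FKConnectivityAllQApexHubThreeAssembly
import Mathlib.Tactic.Positivity
import Mathlib.Tactic.LinearCombination
import HarnessLib

/-!
# Connectivity correlation inequalities for `φ_{w,q}`, every `q > 0` — the HUB INEQUALITY AT AN APEX, file 5e: THREE apex terminals — the algebraic lemma `apexThree_alg` used by `…ApexHubThree.lean`

Support file (`--supports stmt-CriticalPhenomena-4575`), census seat `prim-bschramm-census` (gen 22) of the post-continuity
programme; builds on p205010 (kernel theorem, internal audit signed; external expert review pending).  No definitions, no named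
facts, no sorries; standard axioms.  PURE REAL ALGEBRA (machine-generated by `code/gen_three_blocks.py` of the census seat from the
exact computer-algebra certificate `code/cert3.py`; no measure theory is imported).

THE THREE-APEX HUB INEQUALITY (files `…ApexHubThreeBlocks/PosA/PosB/Assembly/Alg.lean`, then `…ApexHubThree.lean`).  For three
apexes `x` (the hub of the inequality), `y`, `z` over `(u, v)` in an arbitrary weighted graph, the masses `Z, S(y↔x), S(z↔x),
S(y↔x↔z)` are polynomials in the leaf-type weights `N_k = (1−a_k)(1−b_k)`, `U_k = a_k(1−b_k)r`, `V'_k = (1−a_k)b_k r`,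
`W_k = a_k b_k r` (`k = 1,2,3` for `x,y,z`; `r = q⁻¹ = 1+s`) and the base masses `A₀ = S°°°(u ↔ v)`, `B₀ = S°°°(u ↮ v)` (all three
apexes deleted).  The defect `D = Z·S(A∩B) − S(A)S(B)` (1562 monomials in these atoms) is congruent, modulo the leaf relations
`U_k V'_k = W_k N_k (1+s)`, to a polynomial with 1271 NONNEGATIVE integer coefficients (census seat gen 22, exact computer algebra,
cross-checked against brute-force enumeration on `K_{1,1,3}`).  The kernel verification is organised as: twelve BLOCKS
`Q_ij = T_i·TAB_j − TA_i·TB_j` (the slot pairs of the hub apex; `Q_WW = 0`), each expanded by `ring` from the level-two closed forms;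
the ASSEMBLY `Σ c_i c_j Q_ij ≡ certificate` by `linear_combination` with the three relation multipliers (120/165/156 terms); the SIGN by
`positivity`; and `…ThreeAlg.lean` chains them from the structural hypotheses delivered by the table lemma.

THIS FILE: `apexThree_alg` — from the level-one dictionary of `z`, the level-two tables of `y` and the level-three tables of the hub apex `x` (the shapes produced by `apex_mass_table` and `…ApexHubForms/Forms2.lean`) to `S(A)·S(B) ≤ Z·S(A∩B)`.
[cite: AyyerLinussonRavichandran2025, §7 eq. (13)–(15), Conj. 7.1 (p. 22)] [cite: Grimmett2006, Thm. (3.1)(a) (p. 37); §1.4 eq. (1.20) (p. 15)]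
-/

namespace Summit.CriticalPhenomena.PercolationContinuityZ3.Theorems

namespace FK

set_option maxHeartbeats 4000000 in
set_option maxRecDepth 8192 in
/-- Pure algebra for `hubUnder_apex_three` (`(o,a,b) = (y,x,z)`, three apex terminals): given the level-one dictionary of the apex `z`
(in the base masses `A₀, B₀`), the level-two tables of the apex `y` and the level-three tables of the hub apex `x`, in the leaf-type
weights `N_k, U_k, V'_k, W_k` of the three apexes (subject to `U_k V'_k = W_k N_k (1+s)`), `S(A)·S(B) ≤ Z·S(A∩B)`: the defect is the
certificate polynomial of `apexThree_pos` (blocks `apexThree_block_*`, assembly `apexThree_assembly`, sign `apexThree_pos`). [cite: AyyerLinussonRavichandran2025, §7 eq. (13) (p. 22)] -/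
theorem apexThree_alg {N₁ U₁ V₁ W₁ N₂ U₂ V₂ W₂ N₃ U₃ V₃ W₃ s A₀ B₀ Zz UVz UZ VZ ATTz SEPz UVVZ UVUZ Kcz E₁ Zy UV2 UY2 VY2 ATTY SEPY UZ2 VZ2 ATTZ SEPZ BOTH BSEP UU2 VV2 Kc2 E₂ SA SB SAB Z : ℝ}
    (hN₁ : 0 ≤ N₁) (hU₁ : 0 ≤ U₁) (hV₁ : 0 ≤ V₁) (hW₁ : 0 ≤ W₁) (hN₂ : 0 ≤ N₂) (hU₂ : 0 ≤ U₂) (hV₂ : 0 ≤ V₂) (hW₂ : 0 ≤ W₂) (hN₃ : 0 ≤ N₃) (hU₃ : 0 ≤ U₃) (hV₃ : 0 ≤ V₃) (hW₃ : 0 ≤ W₃) (hs : 0 ≤ s) (hA₀ : 0 ≤ A₀) (hB₀ : 0 ≤ B₀)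
    (hrel₁ : U₁ * V₁ = W₁ * N₁ * (1 + s)) (hrel₂ : U₂ * V₂ = W₂ * N₂ * (1 + s)) (hrel₃ : U₃ * V₃ = W₃ * N₃ * (1 + s))
    (hZz : Zz = W₃ * ((A₀ + B₀) + s * B₀) + U₃ * (A₀ + B₀) + V₃ * (A₀ + B₀) + N₃ * (A₀ + B₀))
    (hUVz : UVz = W₃ * ((A₀ + B₀) + s * B₀) + U₃ * A₀ + V₃ * A₀ + N₃ * A₀)
    (hUZ : UZ = W₃ * ((A₀ + B₀) + s * B₀) + U₃ * (A₀ + B₀) + V₃ * A₀)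
    (hVZ : VZ = W₃ * ((A₀ + B₀) + s * B₀) + U₃ * A₀ + V₃ * (A₀ + B₀))
    (hATTz : ATTz = W₃ * ((A₀ + B₀) + s * B₀) + U₃ * (A₀ + B₀) + V₃ * (A₀ + B₀))
    (hSEPz : SEPz = U₃ * B₀ + V₃ * B₀)
    (hUVVZ : UVVZ = W₃ * ((A₀ + B₀) + s * B₀) + U₃ * A₀ + V₃ * A₀)
    (hUVUZ : UVUZ = W₃ * ((A₀ + B₀) + s * B₀) + U₃ * A₀ + V₃ * A₀)
    (hKcz : Kcz = Zz - UVz) (hE₁ : E₁ = 0)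
    (hZy : Zy = W₂ * (Zz + s * Kcz) + U₂ * Zz + V₂ * Zz + N₂ * Zz)
    (hUV2 : UV2 = W₂ * (Zz + s * Kcz) + U₂ * UVz + V₂ * UVz + N₂ * UVz)
    (hUY2 : UY2 = W₂ * (Zz + s * Kcz) + U₂ * Zz + V₂ * UVz)
    (hVY2 : VY2 = W₂ * (Zz + s * Kcz) + U₂ * UVz + V₂ * Zz)
    (hATTY : ATTY = W₂ * (Zz + s * Kcz) + U₂ * Zz + V₂ * Zz)
    (hSEPY : SEPY = U₂ * Kcz + V₂ * Kcz)
    (hUZ2 : UZ2 = W₂ * (ATTz + s * SEPz) + U₂ * UZ + V₂ * UZ + N₂ * UZ)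
    (hVZ2 : VZ2 = W₂ * (ATTz + s * SEPz) + U₂ * VZ + V₂ * VZ + N₂ * VZ)
    (hATTZ : ATTZ = W₂ * (ATTz + s * SEPz) + U₂ * ATTz + V₂ * ATTz + N₂ * ATTz)
    (hSEPZ : SEPZ = W₂ * (E₁ + s * E₁) + U₂ * SEPz + V₂ * SEPz + N₂ * SEPz)
    (hBOTH : BOTH = W₂ * (ATTz + s * SEPz) + U₂ * ATTz + V₂ * ATTz + N₂ * E₁)
    (hBSEP : BSEP = W₂ * (E₁ + s * E₁) + U₂ * SEPz + V₂ * SEPz + N₂ * E₁)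
    (hUU2 : UU2 = W₂ * (ATTz + s * SEPz) + U₂ * UZ + V₂ * UVUZ + N₂ * E₁)
    (hVV2 : VV2 = W₂ * (ATTz + s * SEPz) + U₂ * UVVZ + V₂ * VZ + N₂ * E₁)
    (hKc2 : Kc2 = Zy - UV2) (hE₂ : E₂ = 0)
    (hSA : SA = W₁ * (ATTY + s * SEPY) + U₁ * UY2 + V₁ * VY2 + N₁ * E₂)
    (hSB : SB = W₁ * (ATTZ + s * SEPZ) + U₁ * UZ2 + V₁ * VZ2 + N₁ * E₂)
    (hSAB : SAB = W₁ * (BOTH + s * BSEP) + U₁ * UU2 + V₁ * VV2 + N₁ * E₂)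
    (hZ : Z = W₁ * (Zy + s * Kc2) + U₁ * Zy + V₁ * Zy + N₁ * Zy) :
    SA * SB ≤ Z * SAB := by
  subst hKcz hE₁ hZz hUVz hUZ hVZ hATTz hSEPz hUVVZ hUVUZ hE₂
  have eZy : Zy = (((((((W₂ * W₃ * B₀ + (W₂ * W₃ * A₀ + W₂ * W₃ * s * B₀)) + (W₂ * V₃ * B₀ + (W₂ * V₃ * A₀ + W₂ * V₃ * s * B₀))) + ((W₂ * U₃ * B₀ + (W₂ * U₃ * A₀ + W₂ * U₃ * s * B₀)) + (W₂ * N₃ * B₀ + (W₂ * N₃ * A₀ + W₂ * N₃ * s * B₀)))) + (((V₂ * W₃ * B₀ + (V₂ * W₃ * A₀ + V₂ * W₃ * s * B₀)) + (V₂ * V₃ * B₀ + (V₂ * V₃ * A₀ + V₂ * U₃ * B₀))) + ((V₂ * U₃ * A₀ + (V₂ * N₃ * B₀ + V₂ * N₃ * A₀)) + (U₂ * W₃ * B₀ + (U₂ * W₃ * A₀ + U₂ * W₃ * s * B₀))))) : ℝ)) + (((((U₂ * V₃ * B₀ + (U₂ * V₃ * A₀ + U₂ * U₃ * B₀)) +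 ((U₂ * U₃ * A₀ + U₂ * N₃ * B₀) + (U₂ * N₃ * A₀ + N₂ * W₃ * B₀))) + (((N₂ * W₃ * A₀ + N₂ * W₃ * s * B₀) + (N₂ * V₃ * B₀ + N₂ * V₃ * A₀)) + ((N₂ * U₃ * B₀ + N₂ * U₃ * A₀) + (N₂ * N₃ * B₀ + N₂ * N₃ * A₀)))) : ℝ))) := hZy.trans (by ring)
  have eUV2' : UV2 = (((((((W₂ * W₃ * B₀ + (W₂ * W₃ * A₀ + W₂ * W₃ * s * B₀)) + (W₂ * V₃ * B₀ + (W₂ * V₃ * A₀ + W₂ * V₃ * s * B₀))) + ((W₂ * U₃ * B₀ + (W₂ * U₃ * A₀ + W₂ * U₃ * s * B₀)) + (W₂ * N₃ * B₀ + (W₂ * N₃ * A₀ + W₂ * N₃ * s * B₀)))) + (((V₂ * W₃ * B₀ + (V₂ * W₃ * A₀ + V₂ * W₃ * s * B₀)) + (V₂ * V₃ * A₀ + (V₂ * U₃ * A₀ + V₂ * N₃ * A₀))) + ((U₂ * W₃ * B₀ + (U₂ * W₃ * A₀ + U₂ * W₃ * s * B₀)) + (U₂ * V₃ * A₀ + (U₂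 * U₃ * A₀ + U₂ * N₃ * A₀))))) : ℝ)) + ((((N₂ * W₃ * B₀ + (N₂ * W₃ * A₀ + N₂ * W₃ * s * B₀)) + (N₂ * V₃ * A₀ + (N₂ * U₃ * A₀ + N₂ * N₃ * A₀))) : ℝ))) := hUV2.trans (by ring)
  have eKc2 : Kc2 = (((V₂ * V₃ * B₀ + V₂ * U₃ * B₀) + (V₂ * N₃ * B₀ + U₂ * V₃ * B₀)) + ((U₂ * U₃ * B₀ + U₂ * N₃ * B₀) + (N₂ * V₃ * B₀ + (N₂ * U₃ * B₀ + N₂ * N₃ * B₀)))) := by rw [hKc2, eZy, eUV2']; ring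
  have eUY2 : UY2 = (((((((W₂ * W₃ * B₀ + (W₂ * W₃ * A₀ + W₂ * W₃ * s * B₀)) + (W₂ * V₃ * B₀ + (W₂ * V₃ * A₀ + W₂ * V₃ * s * B₀))) + ((W₂ * U₃ * B₀ + (W₂ * U₃ * A₀ + W₂ * U₃ * s * B₀)) + (W₂ * N₃ * B₀ + (W₂ * N₃ * A₀ + W₂ * N₃ * s * B₀)))) + (((V₂ * W₃ * B₀ + (V₂ * W₃ * A₀ + V₂ * W₃ * s * B₀)) + (V₂ * V₃ * A₀ + (V₂ * U₃ * A₀ + V₂ * N₃ * A₀))) + ((U₂ * W₃ * B₀ + (U₂ * W₃ * A₀ + U₂ * W₃ * s * B₀)) + (U₂ * V₃ * B₀ + (U₂ * V₃ * A₀ + U₂ * U₃ * B₀))))) : ℝ)) + (((U₂ * U₃ * A₀ + (U₂ * N₃ * B₀ + U₂ * N₃ * A₀)) : ℝ))) := hUY2.trans (by ring)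
  have eVY2 : VY2 = (((((((W₂ * W₃ * B₀ + (W₂ * W₃ * A₀ + W₂ * W₃ * s * B₀)) + (W₂ * V₃ * B₀ + (W₂ * V₃ * A₀ + W₂ * V₃ * s * B₀))) + ((W₂ * U₃ * B₀ + (W₂ * U₃ * A₀ + W₂ * U₃ * s * B₀)) + (W₂ * N₃ * B₀ + (W₂ * N₃ * A₀ + W₂ * N₃ * s * B₀)))) + (((V₂ * W₃ * B₀ + (V₂ * W₃ * A₀ + V₂ * W₃ * s * B₀)) + (V₂ * V₃ * B₀ + (V₂ * V₃ * A₀ + V₂ * U₃ * B₀))) + ((V₂ * U₃ * A₀ + (V₂ * N₃ * B₀ + V₂ * N₃ * A₀)) + (U₂ * W₃ * B₀ + (U₂ * W₃ * A₀ + U₂ * W₃ * s * B₀))))) : ℝ)) + (((U₂ * V₃ * A₀ + (U₂ * U₃ * A₀ + U₂ * N₃ * A₀)) : ℝ))) := hVY2.trans (by ring)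
  have eATTY : ATTY = (((((((W₂ * W₃ * B₀ + (W₂ * W₃ * A₀ + W₂ * W₃ * s * B₀)) + (W₂ * V₃ * B₀ + (W₂ * V₃ * A₀ + W₂ * V₃ * s * B₀))) + ((W₂ * U₃ * B₀ + (W₂ * U₃ * A₀ + W₂ * U₃ * s * B₀)) + (W₂ * N₃ * B₀ + (W₂ * N₃ * A₀ + W₂ * N₃ * s * B₀)))) + (((V₂ * W₃ * B₀ + (V₂ * W₃ * A₀ + V₂ * W₃ * s * B₀)) + (V₂ * V₃ * B₀ + (V₂ * V₃ * A₀ + V₂ * U₃ * B₀))) + ((V₂ * U₃ * A₀ + (V₂ * N₃ * B₀ + V₂ * N₃ * A₀)) + (U₂ * W₃ * B₀ + (U₂ * W₃ * A₀ + U₂ * W₃ * s * B₀))))) : ℝ)) + ((((U₂ * V₃ * B₀ + (U₂ * V₃ * A₀ + U₂ * U₃ * B₀)) + (U₂ * U₃ * A₀ + (U₂ * N₃ * B₀ + U₂ * N₃ * A₀))) : ℝ))) := hATTY.trans (by ring)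
  have eSEPY : SEPY = ((V₂ * V₃ * B₀ + (V₂ * U₃ * B₀ + V₂ * N₃ * B₀)) + (U₂ * V₃ * B₀ + (U₂ * U₃ * B₀ + U₂ * N₃ * B₀))) := hSEPY.trans (by ring)
  have eUZ2 : UZ2 = (((((((W₂ * W₃ * B₀ + (W₂ * W₃ * A₀ + W₂ * W₃ * s * B₀)) + (W₂ * V₃ * B₀ + (W₂ * V₃ * A₀ + W₂ * V₃ * s * B₀))) + ((W₂ * U₃ * B₀ + (W₂ * U₃ * A₀ + W₂ * U₃ * s * B₀)) + (V₂ * W₃ * B₀ + (V₂ * W₃ * A₀ + V₂ * W₃ * s * B₀)))) + (((V₂ * V₃ * A₀ + (V₂ * U₃ * B₀ + V₂ * U₃ * A₀)) + (U₂ * W₃ * B₀ + (U₂ * W₃ * A₀ + U₂ * W₃ * s * B₀))) + ((U₂ * V₃ * A₀ + (U₂ * U₃ * B₀ + U₂ * U₃ * A₀)) + (N₂ * W₃ * B₀ + (N₂ * W₃ * A₀ + N₂ * W₃ * s * B₀))))) : ℝ)) + (((N₂ * V₃ * A₀ + (N₂ * U₃ * B₀ + N₂ * U₃ * A₀)) :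 ℝ))) := hUZ2.trans (by ring)
  have eVZ2 : VZ2 = (((((((W₂ * W₃ * B₀ + (W₂ * W₃ * A₀ + W₂ * W₃ * s * B₀)) + (W₂ * V₃ * B₀ + (W₂ * V₃ * A₀ + W₂ * V₃ * s * B₀))) + ((W₂ * U₃ * B₀ + (W₂ * U₃ * A₀ + W₂ * U₃ * s * B₀)) + (V₂ * W₃ * B₀ + (V₂ * W₃ * A₀ + V₂ * W₃ * s * B₀)))) + (((V₂ * V₃ * B₀ + (V₂ * V₃ * A₀ + V₂ * U₃ * A₀)) + (U₂ * W₃ * B₀ + (U₂ * W₃ * A₀ + U₂ * W₃ * s * B₀))) + ((U₂ * V₃ * B₀ + (U₂ * V₃ * A₀ + U₂ * U₃ * A₀)) + (N₂ * W₃ * B₀ + (N₂ * W₃ * A₀ + N₂ * W₃ * s * B₀))))) : ℝ)) + (((N₂ * V₃ * B₀ + (N₂ * V₃ * A₀ + N₂ * U₃ * A₀)) : ℝ))) := hVZ2.trans (by ring)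
  have eATTZ : ATTZ = (((((((W₂ * W₃ * B₀ + (W₂ * W₃ * A₀ + W₂ * W₃ * s * B₀)) + (W₂ * V₃ * B₀ + (W₂ * V₃ * A₀ + W₂ * V₃ * s * B₀))) + ((W₂ * U₃ * B₀ + (W₂ * U₃ * A₀ + W₂ * U₃ * s * B₀)) + (V₂ * W₃ * B₀ + (V₂ * W₃ * A₀ + V₂ * W₃ * s * B₀)))) + (((V₂ * V₃ * B₀ + (V₂ * V₃ * A₀ + V₂ * U₃ * B₀)) + (V₂ * U₃ * A₀ + (U₂ * W₃ * B₀ + U₂ * W₃ * A₀))) + ((U₂ * W₃ * s * B₀ + (U₂ * V₃ * B₀ + U₂ * V₃ * A₀)) + (U₂ * U₃ * B₀ + (U₂ * U₃ * A₀ + N₂ * W₃ * B₀))))) : ℝ)) + ((((N₂ * W₃ * A₀ + (N₂ * W₃ * s * B₀ + N₂ * V₃ * B₀)) + (N₂ * V₃ * A₀ + (N₂ * U₃ * B₀ + N₂ * U₃ * A₀))) : ℝ))) := hATTZ.trans (by ring)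
  have eSEPZ : SEPZ = ((V₂ * V₃ * B₀ + (V₂ * U₃ * B₀ + U₂ * V₃ * B₀)) + (U₂ * U₃ * B₀ + (N₂ * V₃ * B₀ + N₂ * U₃ * B₀))) := hSEPZ.trans (by ring)
  have eBOTH : BOTH = ((((W₂ * W₃ * B₀ + W₂ * W₃ * A₀) + (W₂ * W₃ * s * B₀ + (W₂ * V₃ * B₀ + W₂ * V₃ * A₀))) + ((W₂ * V₃ * s * B₀ + (W₂ * U₃ * B₀ + W₂ * U₃ * A₀)) + (W₂ * U₃ * s * B₀ + (V₂ * W₃ * B₀ + V₂ * W₃ * A₀)))) + (((V₂ * W₃ * s * B₀ + (V₂ * V₃ * B₀ + V₂ * V₃ * A₀)) + (V₂ * U₃ * B₀ + (V₂ * U₃ * A₀ + U₂ * W₃ * B₀))) + ((U₂ * W₃ * A₀ + (U₂ * W₃ * s * B₀ + U₂ * V₃ * B₀)) + (U₂ * V₃ * A₀ + (U₂ * U₃ * B₀ + U₂ * U₃ * A₀))))) := hBOTH.trans (by ring)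
  have eBSEP : BSEP = ((V₂ * V₃ * B₀ + V₂ * U₃ * B₀) + (U₂ * V₃ * B₀ + U₂ * U₃ * B₀)) := hBSEP.trans (by ring)
  have eUU2 : UU2 = ((((W₂ * W₃ * B₀ + W₂ * W₃ * A₀) + (W₂ * W₃ * s * B₀ + (W₂ * V₃ * B₀ + W₂ * V₃ * A₀))) + ((W₂ * V₃ * s * B₀ + W₂ * U₃ * B₀) + (W₂ * U₃ * A₀ + (W₂ * U₃ * s * B₀ + V₂ * W₃ * B₀)))) + (((V₂ * W₃ * A₀ + V₂ * W₃ * s * B₀) + (V₂ * V₃ * A₀ + (V₂ * U₃ * A₀ + U₂ * W₃ * B₀))) + ((U₂ * W₃ * A₀ + U₂ * W₃ * s * B₀) + (U₂ * V₃ * A₀ + (U₂ * U₃ * B₀ + U₂ * U₃ * A₀))))) := hUU2.trans (by ring)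
  have eVV2 : VV2 = ((((W₂ * W₃ * B₀ + W₂ * W₃ * A₀) + (W₂ * W₃ * s * B₀ + (W₂ * V₃ * B₀ + W₂ * V₃ * A₀))) + ((W₂ * V₃ * s * B₀ + W₂ * U₃ * B₀) + (W₂ * U₃ * A₀ + (W₂ * U₃ * s * B₀ + V₂ * W₃ * B₀)))) + (((V₂ * W₃ * A₀ + V₂ * W₃ * s * B₀) + (V₂ * V₃ * B₀ + (V₂ * V₃ * A₀ + V₂ * U₃ * A₀))) + ((U₂ * W₃ * B₀ + U₂ * W₃ * A₀) + (U₂ * W₃ * s * B₀ + (U₂ * V₃ * A₀ + U₂ * U₃ * A₀))))) := hVV2.trans (by ring)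
  have hD : Z * SAB - SA * SB =
      (((W₁ * W₁ * ((Zy + s * Kc2) * (BOTH + s * BSEP) - (ATTY + s * SEPY) * (ATTZ + s * SEPZ)) + (W₁ * U₁ * ((Zy + s * Kc2) * UU2 - (ATTY + s * SEPY) * UZ2) + W₁ * V₁ * ((Zy + s * Kc2) * VV2 - (ATTY + s * SEPY) * VZ2))) + (U₁ * W₁ * (Zy * (BOTH + s * BSEP) - UY2 * (ATTZ + s * SEPZ)) + (U₁ * U₁ * (Zy * UU2 - UY2 * UZ2) + U₁ * V₁ * (Zy * VV2 - UY2 * VZ2)))) + ((V₁ * W₁ * (Zy * (BOTH + s * BSEP) - VY2 * (ATTZ + s * SEPZ)) + (V₁ * U₁ * (Zy * UU2 - VY2 * UZ2) + V₁ * V₁ * (Zy * VV2 - VY2 * VZ2))) + (N₁ * W₁ * (Zy * (BOTH + s * BSEP)) + (N₁ * U₁ * (Zy * UU2) + N₁ * V₁ * (Zy * VV2))))) := by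
    subst hSA hSB hSAB hZ
    ring
  exact sub_nonneg.1 ((apexThree_pos hN₁ hU₁ hV₁ hW₁ hN₂ hU₂ hV₂ hW₂ hN₃ hU₃ hV₃ hW₃ hs hA₀ hB₀).trans_eq
    (hD.trans (apexThree_assembly hrel₁ hrel₂ hrel₃ eZy eKc2 eUY2 eVY2 eATTY eSEPY eUZ2 eVZ2 eATTZ eSEPZ eBOTH eBSEP eUU2 eVV2)).symm)

end FK

end Summit.CriticalPhenomena.PercolationContinuityZ3.Theorems
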